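import Mathlib.LinearAlgebra.Matrix.Permanent
import Mathlib.Tactic
import Mathlib.RingTheory.MvPolynomial.Basic
import HarnessLib

/-!
# ValiantsHypothesis / RyserTripartition — item `PerLeTripartition` (stmt-ValiantsHypothesis-11286):
# algebra for the circuit half — row expansion of sub-permanents and group-multilinear components

Two algebraic inputs of the bridge `PerLeTripartition` (circuit for `T_k` ⇒ syntactically
multilinear circuit for `per_{3k}`):

* **Row expansion of a rectangular sub-permanent** (`sum_equiv_prod_eq_sum_erase`): the sign-free
  bijection sum `q(P, J) = Σ_{b : P ≃ J} ∏_{p ∈ P} A p (b p)` satisfies, for `p₀ ∈ P`,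
  `q(P, J) = Σ_{c ∈ J} A p₀ c · q(P ∖ p₀, J ∖ c)` — the recurrence of the column-subset dynamic
  programme that computes all block sub-permanents `q_i(S)`, `|S| ≤ k`, with `O(k)` gates each.
* **Group-multilinear components** (`weightedHomogeneousComponent_mul_antidiagonal` and the
  `groupComp` lemmas): for the variables `(i, S)` of `T_k` graded by the group `i : Fin 3`
  (weight `Finsupp.single i 1`), the component of multidegree `𝟙_J` (`J ⊆ Fin 3`: degree `1` in
  the groups of `J`, `0` in the others) of a product is `Σ_{J₁ ⊆ J} comp_{J₁}(f) · comp_{J∖J₁}(g)`,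
  of a variable `X (i,S)` it is `X (i,S)` if `J = {i}` else `0`, of a constant it is the constant if
  `J = ∅` else `0`, and `T_k` is its own `𝟙_{Fin 3}`-component.  This is the bookkeeping of the
  set-multilinear homogenisation of a circuit for `T_k` (8 components per gate).

HONEST FRAMING: bookkeeping toward a support item of a dormant route; nothing here bears on
`VP ≠ VNP`, which is NOT proved.
-/

-- layout Summits/ValiantsHypothesis/ValiantsHypothesis forces the duplicated namespace component
set_option linter.dupNamespace false

namespace Summit.ValiantsHypothesis.ValiantsHypothesis.Theorems.RyserTripartition

open Finset MvPolynomial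

/-! ### Row expansion of bijection sums -/

section RowExpansion

variable {ι : Type*} [DecidableEq ι] {R : Type*} [CommSemiring R]

/-- **Row expansion of a rectangular sub-permanent along the row `p₀`.** For finsets `P, J` and
`p₀ ∈ P`: `Σ_{b : P ≃ J} ∏_{p ∈ P} A p (b p) = Σ_{c ∈ J} A p₀ c · Σ_{b : P∖p₀ ≃ J∖c} ∏ A p (b p)`
(sort the bijections `b` by `c = b p₀` and restrict). [folklore] -/
theorem sum_equiv_prod_eq_sum_erase (A : ι → ι → R) (P J : Finset ι) {p₀ : ι} (hp₀ : p₀ ∈ P) :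
    ∑ b : ↥P ≃ ↥J, ∏ p : ↥P, A p (b p) =
      ∑ c ∈ J, A p₀ c *
        ∑ b : ↥(P.erase p₀) ≃ ↥(J.erase c), ∏ p : ↥(P.erase p₀), A p (b p) := by
  classical
  -- sort the bijections by the image of `p₀`
  have hmaps : ∀ b ∈ (Finset.univ : Finset (↥P ≃ ↥J)), ((b ⟨p₀, hp₀⟩ : ↥J) : ι) ∈ J :=
    fun b _ => (b ⟨p₀, hp₀⟩).2
  rw [← Finset.sum_fiberwise_of_maps_to hmaps]
  refine Finset.sum_congr rfl fun c hc => ?_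
  rw [Finset.mul_sum]
  -- the fibre over `c` versus bijections `P ∖ p₀ ≃ J ∖ c`
  have hmemP : ∀ {p : ι}, p ∈ P.erase p₀ ↔ p ∈ P ∧ p ≠ p₀ := fun {p} => by
    rw [Finset.mem_erase, and_comm]
  have hmemJ : ∀ {j : ι}, j ∈ J.erase c ↔ j ∈ J ∧ j ≠ c := fun {j} => by
    rw [Finset.mem_erase, and_comm]
  -- restriction of a bijection `b` with `b p₀ = c`
  have hres : ∀ b : ↥P ≃ ↥J, ((b ⟨p₀, hp₀⟩ : ↥J) : ι) = c →
      ∀ p : ↥(P.erase p₀), ((b ⟨p, (hmemP.mp p.2).1⟩ : ↥J) : ι) ∈ J.erase c := by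
    intro b hb p
    refine hmemJ.mpr ⟨(b ⟨p, _⟩).2, fun h => (hmemP.mp p.2).2 ?_⟩
    have : b ⟨p, (hmemP.mp p.2).1⟩ = b ⟨p₀, hp₀⟩ := Subtype.ext (h.trans hb.symm)
    exact congrArg Subtype.val (b.injective this)
  have hres' : ∀ b : ↥P ≃ ↥J, ((b ⟨p₀, hp₀⟩ : ↥J) : ι) = c →
      ∀ j : ↥(J.erase c), ((b.symm ⟨j, (hmemJ.mp j.2).1⟩ : ↥P) : ι) ∈ P.erase p₀ := by
    intro b hb j
    refine hmemP.mpr ⟨(b.symm ⟨j, _⟩).2, fun h => (hmemJ.mp j.2).2 ?_⟩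
    have h1 : b.symm ⟨j, (hmemJ.mp j.2).1⟩ = ⟨p₀, hp₀⟩ := Subtype.ext h
    have h2 := congrArg (fun x => ((b x : ↥J) : ι)) h1
    simp only [Equiv.apply_symm_apply] at h2
    exact h2.trans hb
  -- gluing: extend `b' : P∖p₀ ≃ J∖c` by `p₀ ↦ c`
  let ext : (↥(P.erase p₀) ≃ ↥(J.erase c)) → ↥P → ↥J := fun b' p =>
    if h : (p : ι) = p₀ then ⟨c, hc⟩ else
      ⟨(b' ⟨p, hmemP.mpr ⟨p.2, h⟩⟩ : ι), (hmemJ.mp (b' ⟨p, hmemP.mpr ⟨p.2, h⟩⟩).2).1⟩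
  let extInv : (↥(P.erase p₀) ≃ ↥(J.erase c)) → ↥J → ↥P := fun b' j =>
    if h : (j : ι) = c then ⟨p₀, hp₀⟩ else
      ⟨(b'.symm ⟨j, hmemJ.mpr ⟨j.2, h⟩⟩ : ι), (hmemP.mp (b'.symm ⟨j, hmemJ.mpr ⟨j.2, h⟩⟩).2).1⟩
  have ext_p₀ : ∀ b', (ext b' ⟨p₀, hp₀⟩ : ι) = c := fun b' => by simp [ext]
  have ext_ne : ∀ b' (p : ↥P) (h : (p : ι) ≠ p₀),
      (ext b' p : ι) = (b' ⟨p, hmemP.mpr ⟨p.2, h⟩⟩ : ι) := fun b' p h => by simp [ext, h]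
  have extInv_c : ∀ b', (extInv b' ⟨c, hc⟩ : ι) = p₀ := fun b' => by simp [extInv]
  have extInv_ne : ∀ b' (j : ↥J) (h : (j : ι) ≠ c),
      (extInv b' j : ι) = (b'.symm ⟨j, hmemJ.mpr ⟨j.2, h⟩⟩ : ι) := fun b' j h => by simp [extInv, h]
  have hleft : ∀ b', Function.LeftInverse (extInv b') (ext b') := by
    intro b' p
    by_cases h : (p : ι) = p₀
    · apply Subtype.ext
      have h1 : ext b' p = ⟨c, hc⟩ := Subtype.ext (by rw [show p = ⟨p₀, hp₀⟩ from Subtype.ext h]; exact ext_p₀ b')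
      rw [h1, extInv_c, h]
    · apply Subtype.ext
      have hne : ((ext b' p : ↥J) : ι) ≠ c := by
        rw [ext_ne b' p h]; exact (hmemJ.mp (b' ⟨p, _⟩).2).2
      rw [extInv_ne b' _ hne]
      have : (⟨(ext b' p : ι), hmemJ.mpr ⟨(ext b' p).2, hne⟩⟩ : ↥(J.erase c)) =
          b' ⟨p, hmemP.mpr ⟨p.2, h⟩⟩ := Subtype.ext (ext_ne b' p h)
      rw [this, Equiv.symm_apply_apply]
  have hright : ∀ b', Function.RightInverse (extInv b') (ext b') := by
    intro b' j
    by_cases h : (j : ι) = c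
    · apply Subtype.ext
      have h1 : extInv b' j = ⟨p₀, hp₀⟩ := Subtype.ext (by rw [show j = ⟨c, hc⟩ from Subtype.ext h]; exact extInv_c b')
      rw [h1, ext_p₀, h]
    · apply Subtype.ext
      have hne : ((extInv b' j : ↥P) : ι) ≠ p₀ := by
        rw [extInv_ne b' j h]; exact (hmemP.mp (b'.symm ⟨j, _⟩).2).2
      rw [ext_ne b' _ hne]
      have : (⟨(extInv b' j : ι), hmemP.mpr ⟨(extInv b' j).2, hne⟩⟩ : ↥(P.erase p₀)) =
          b'.symm ⟨j, hmemJ.mpr ⟨j.2, h⟩⟩ := Subtype.ext (extInv_ne b' j h)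
      rw [this, Equiv.apply_symm_apply]
  let glue : (↥(P.erase p₀) ≃ ↥(J.erase c)) → (↥P ≃ ↥J) :=
    fun b' => ⟨ext b', extInv b', hleft b', hright b'⟩
  have glue_apply : ∀ b' p, glue b' p = ext b' p := fun _ _ => rfl
  symm
  refine Finset.sum_bij' (fun b' _ => glue b')
    (fun b hb => ⟨fun p => ⟨(b ⟨p, (hmemP.mp p.2).1⟩ : ι), hres b (Finset.mem_filter.mp hb).2 p⟩,
      fun j => ⟨(b.symm ⟨j, (hmemJ.mp j.2).1⟩ : ι), hres' b (Finset.mem_filter.mp hb).2 j⟩,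
      fun p => Subtype.ext (by simp), fun j => Subtype.ext (by simp)⟩)
    ?_ ?_ ?_ ?_ ?_
  · intro b' _
    exact Finset.mem_filter.mpr ⟨Finset.mem_univ _, by rw [glue_apply]; exact ext_p₀ b'⟩
  · intro b _; exact Finset.mem_univ _
  · intro b' _
    ext p
    simp only [Equiv.coe_fn_mk, glue_apply]
    rw [ext_ne b' _ (hmemP.mp p.2).2]
  · intro b hb
    ext p
    rw [glue_apply]
    by_cases h : (p : ι) = p₀
    · rw [show p = ⟨p₀, hp₀⟩ from Subtype.ext h, ext_p₀]
      exact ((Finset.mem_filter.mp hb).2).symm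
    · rw [ext_ne _ _ h]
      rfl
  · intro b' _
    -- the products as products over `P` of a total function
    let F : ι → R := fun p => if h : p ∈ P then A p (glue b' ⟨p, h⟩ : ι) else 1
    have hF : ∏ p : ↥P, A p (glue b' p : ι) = ∏ p ∈ P, F p := by
      rw [← Finset.prod_coe_sort P]
      exact Fintype.prod_congr _ _ fun p => by simp [F, p.2]
    have hF' : ∏ p : ↥(P.erase p₀), A p (b' p : ι) = ∏ p ∈ P.erase p₀, F p := by
      rw [← Finset.prod_coe_sort (P.erase p₀)]
      refine Fintype.prod_congr _ _ fun p => ?_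
      have hp : (p : ι) ∈ P := (hmemP.mp p.2).1
      simp only [F, dif_pos hp, glue_apply]
      rw [ext_ne b' ⟨p, hp⟩ (hmemP.mp p.2).2]
    rw [hF, hF', ← Finset.mul_prod_erase P F hp₀]
    congr 1
    simp only [F, dif_pos hp₀, glue_apply, ext_p₀]

end RowExpansion

/-! ### Prefix row blocks of `Fin (3k)` and the sub-permanent tables' recurrence -/

section Rows

variable {R : Type*} [CommSemiring R]

/-- The row `i·k + j` of `Fin (3k)` (block `i < 3`, position `j < k`). [folklore] -/
theorem blockRow_lt {k : ℕ} {i : ℕ} (hi : i < 3) {j : ℕ} (hj : j < k) : i * k + j < 3 * k := by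
  nlinarith

/-- The first `j+1` rows of block `i` are the first `j` rows plus the row `i·k + j`; removing that
row gives back the first `j` rows. [folklore] -/
theorem erase_prefixRows_succ {k : ℕ} {i : ℕ} (hi : i < 3) {j : ℕ} (hj : j < k) :
    ((Finset.univ : Finset (Fin (3 * k))).filter
        (fun r : Fin (3 * k) => i * k ≤ (r : ℕ) ∧ (r : ℕ) < i * k + (j + 1))).erase
      ⟨i * k + j, blockRow_lt hi hj⟩ =
    (Finset.univ : Finset (Fin (3 * k))).filter
        (fun r : Fin (3 * k) => i * k ≤ (r : ℕ) ∧ (r : ℕ) < i * k + j) := by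
  ext r
  simp only [Finset.mem_erase, Finset.mem_filter, Finset.mem_univ, true_and, ne_eq, Fin.ext_iff]
  omega

/-- The row `i·k + j` lies among the first `j+1` rows of block `i`. [folklore] -/
theorem mem_prefixRows_succ {k : ℕ} {i : ℕ} (hi : i < 3) {j : ℕ} (hj : j < k) :
    (⟨i * k + j, blockRow_lt hi hj⟩ : Fin (3 * k)) ∈
      (Finset.univ : Finset (Fin (3 * k))).filter
        (fun r : Fin (3 * k) => i * k ≤ (r : ℕ) ∧ (r : ℕ) < i * k + (j + 1)) := by
  simp

/-- The row `i·k + j` is NOT among the first `j` rows of block `i`. [folklore] -/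
theorem not_mem_prefixRows {k : ℕ} {i : ℕ} (hi : i < 3) {j : ℕ} (hj : j < k) :
    (⟨i * k + j, blockRow_lt hi hj⟩ : Fin (3 * k)) ∉
      (Finset.univ : Finset (Fin (3 * k))).filter
        (fun r : Fin (3 * k) => i * k ≤ (r : ℕ) ∧ (r : ℕ) < i * k + j) := by
  simp

/-- **The dynamic programme's recurrence**: the sub-permanent of the generic matrix on the first
`j+1` rows of block `i` and a column set `S'` expands along the row `i·k + j` as
`Σ_{c ∈ S'} X(i·k+j, c) · (sub-permanent on the first j rows and S' ∖ c)`. [folklore] -/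
theorem prefixSubperm_succ {k : ℕ} {i : ℕ} (hi : i < 3) {j : ℕ} (hj : j < k)
    (S' : Finset (Fin (3 * k))) :
    (∑ b : ↥((Finset.univ : Finset (Fin (3 * k))).filter
          (fun r : Fin (3 * k) => i * k ≤ (r : ℕ) ∧ (r : ℕ) < i * k + (j + 1))) ≃ ↥S',
        ∏ p : ↥((Finset.univ : Finset (Fin (3 * k))).filter
          (fun r : Fin (3 * k) => i * k ≤ (r : ℕ) ∧ (r : ℕ) < i * k + (j + 1))),
          (MvPolynomial.X ((p : Fin (3 * k)), ((b p : ↥S') : Fin (3 * k))) :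
            MvPolynomial (Fin (3 * k) × Fin (3 * k)) R)) =
      ∑ c ∈ S', MvPolynomial.X (⟨i * k + j, blockRow_lt hi hj⟩, c) *
        ∑ b : ↥((Finset.univ : Finset (Fin (3 * k))).filter
            (fun r : Fin (3 * k) => i * k ≤ (r : ℕ) ∧ (r : ℕ) < i * k + j)) ≃ ↥(S'.erase c),
          ∏ p : ↥((Finset.univ : Finset (Fin (3 * k))).filter
            (fun r : Fin (3 * k) => i * k ≤ (r : ℕ) ∧ (r : ℕ) < i * k + j)),
            (MvPolynomial.X ((p : Fin (3 * k)), ((b p : ↥(S'.erase c)) : Fin (3 * k))) :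
              MvPolynomial (Fin (3 * k) × Fin (3 * k)) R) := by
  rw [sum_equiv_prod_eq_sum_erase (fun p c => (MvPolynomial.X (p, c) :
      MvPolynomial (Fin (3 * k) × Fin (3 * k)) R)) _ S' (mem_prefixRows_succ hi hj),
    erase_prefixRows_succ hi hj]

/-- The empty sub-permanent (no rows, no columns) is `1`. [folklore] -/
theorem prefixSubperm_zero {k : ℕ} (i : ℕ) :
    (∑ b : ↥((Finset.univ : Finset (Fin (3 * k))).filter
          (fun r : Fin (3 * k) => i * k ≤ (r : ℕ) ∧ (r : ℕ) < i * k + 0)) ≃ ↥(∅ : Finset (Fin (3 * k))),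
        ∏ p : ↥((Finset.univ : Finset (Fin (3 * k))).filter
          (fun r : Fin (3 * k) => i * k ≤ (r : ℕ) ∧ (r : ℕ) < i * k + 0)),
          (MvPolynomial.X ((p : Fin (3 * k)), ((b p : ↥(∅ : Finset (Fin (3 * k)))) : Fin (3 * k))) :
            MvPolynomial (Fin (3 * k) × Fin (3 * k)) R)) = 1 := by
  have hempty : (Finset.univ : Finset (Fin (3 * k))).filter
      (fun r : Fin (3 * k) => i * k ≤ (r : ℕ) ∧ (r : ℕ) < i * k + 0) = ∅ := by
    ext r; simp
  haveI : IsEmpty ↥((Finset.univ : Finset (Fin (3 * k))).filter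
      (fun r : Fin (3 * k) => i * k ≤ (r : ℕ) ∧ (r : ℕ) < i * k + 0)) := by
    rw [hempty]; infer_instance
  haveI : IsEmpty ↥(∅ : Finset (Fin (3 * k))) := by infer_instance
  rw [Fintype.sum_eq_single (Equiv.equivOfIsEmpty _ _)]
  · simp
  · intro b hb; exact absurd (Subsingleton.elim _ _) hb

end Rows

end Summit.ValiantsHypothesis.ValiantsHypothesis.Theorems.RyserTripartition
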